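import Literature.NumberTheory.EllipticCurves.Rank1Residual.GVParityOrdinaryLineProofs
import Literature.NumberTheory.EllipticCurves.Rank1Residual.GVParityTwistProofs
import Literature.NumberTheory.EllipticCurves.Rank1Residual.ClassX1KellerYinTypeA
import Literature.NumberTheory.EllipticCurves.SelmerCorankProofs
import HarnessLib

/-!
# The Greenberg–Vatsal type of a rational `p`-isogeny kernel does not depend on the kernel; a
# rational `p`-torsion point in the isogeny class forces type A (class X1a needs Keller–Yin alone)

HONEST FRAMING (cell `b2b-bsdres`, home `run/shared/lean/b2b/bsd-rank1-residual/`): the cell deletes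
COMBINATION-SHAPED residual classes of the rank-`≤ 1` BSD formula from PUBLISHED theorems only and
types the rest; this is not "finishing BSD". `Proofs`-style file (theorems only, no definition, no
named fact), prover x1a gen 3, sequel of `GVParityOrdinaryLineProofs.lean` ((hL) discharged).

With Serre's ordinary line (hL) and the signs of complex conjugation (hc) both THEOREMS at a good
ordinary odd prime `p` of `E/ℚ`, the semisimplification `E[p]^ss = φ ⊕ ψ` (`φψ = ω`) has exactly
one constituent unramified at `p` and exactly one even constituent; so the Greenberg–Vatsal
condition "(ramified at `p` ∧ even) ∨ (unramified at `p` ∧ odd)" [Greenberg–Vatsal 2000, Thm. 1.3]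
on a rational `p`-isogeny kernel `Φ` says "the unramified constituent is odd" and does NOT depend on
`Φ` — the census flag M of `b2b-bsdres-x1a/X1-CENSUS-g2.md` §1 ("all kernels of one curve have
the same type", checked on 3413 curves), now in the kernel:

* `gvType_iff_of_isRationalLine` — for two rational lines `Φ₁, Φ₂ ≤ E[p]` at a good ordinary odd
  `p` (globally minimal `W`): `Φ₁` is of GV type iff `Φ₂` is (the case `Φ₁ ≠ Φ₂`, i.e.
  `E[p] = Φ₁ ⊕ Φ₂` split, is the content: not both ramified — each would be Serre's line —, not
  both unramified — inertia moves Serre's line —, not both even / both odd — `det ρ̄(c) = -1`).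
* `not_gvPar_of_isRationalLine` — hence ONE rational line of co-type ((unr ∧ even) ∨ (ram ∧ odd))
  makes the curve of type A (`¬ GVPar W p`).
* `not_gvPar_of_nsmul_eq_zero` — **a rational point of order `p` forces type A**: the line it
  spans is fixed pointwise by `Γ_ℚ`, so unramified and even. With isogeny invariance
  (`gvPar_iff_of_isogeny_of_anom`): `not_gvPar_of_isogeny_of_nsmul_eq_zero` — a rational
  `p`-torsion point ANYWHERE in the isogeny class (isogenies not killing `E[p]`) forces type A
  (census §2d: 1438 of the 1487 type-A classes `N < 2·10⁴` are of this kind; no type-B class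
  contains rational `p`-torsion).
* `bsdp_of_classX1_of_analyticRank_eq_one_of_KY_OPEN_of_nsmul_eq_zero` (+ `_of_isogeny_…`) — so on
  class X1 with `r_an = 1`, a rational `p`-torsion point on the curve (or on an isogenous globally
  minimal anomalous curve) puts the pair in sub-class X1a: `BSD(E,p)` follows from Keller–Yin's
  rank-one display (ANNOUNCED, arXiv:2402.12781v2 Thms 3.0.11 + 7.0.6; hypothesis `hKY_OPEN`) and
  PUBLISHED named facts only (`bsdp_of_classX1_typeA_of_analyticRank_eq_one_of_KY_OPEN`, gen 1) —
  a criterion read off Cremona's torsion column instead of the kernel-polynomial computation.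

## References
* R. Greenberg, V. Vatsal, Invent. Math. 142 (2000), Thm. (1.3) and the discussion of `X_0(11)`
  after it ("if `E` is a quadratic twist of `J` by an even character, we can prove very little").
  [GreenbergVatsal2000]
* J.-P. Serre, Invent. Math. 15 (1972), §1.11, Prop. 11 and Cor. [SerreInventiones1972]
* T. Keller, M. Yin, arXiv:2402.12781v2 (2024), Thm. 4.2.1 (PRE, announced). [KellerYin2024]
-/

set_option autoImplicit false

noncomputable section

open scoped Classical

open WeierstrassCurve Literature.NumberTheory.EllipticCurves Literature.NumberTheory.GaloisRepresentations
  Literature.NumberTheory.EllipticCurves.ModularForms Field IsDedekindDomain NumberField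

/-! ### `E(K) ↪ E(K̄)` and torsion (any field) -/

namespace WeierstrassCurve

/-- For `P ∈ E(K)` with `n • P = O`: `n • P = O` in `E(K̄)` (the inclusion `toGeomPoints` is
additive). Stated for a general field, where the group law on `E(K)` is Mathlib's for the classical
decidability instance (the one `toGeomPoints` is additive for); over `ℚ` apply it with
`(by convert h)`, the two `DecidableEq ℚ` instances being equal. [folklore] -/
theorem zsmul_toGeomPoints_eq_zero_of_nsmul_eq_zero {K : Type*} [Field K] (W : WeierstrassCurve K)
    (P : W.toAffine.Point) {n : ℕ} (h : n • P = 0) : (n : ℤ) • W.toGeomPoints P = 0 := by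
  rw [natCast_zsmul, ← map_nsmul, h, map_zero]

end WeierstrassCurve

namespace Literature.NumberTheory.EllipticCurves.Rank1Residual

variable {W W' : WeierstrassCurve ℚ} [W.IsElliptic] [W'.IsElliptic] {p : ℕ} [Fact p.Prime]

/-! ### Two distinct rational lines span `E[p]` -/

omit [W.IsElliptic] in
/-- Two distinct subgroups of order `p` of `E[p]` (order `p²`) generate it. [folklore] -/
theorem sup_eq_top_of_ne (hE : Nat.card (geomTorsion W (p : ℤ)) = p ^ 2)
    {Φ₁ Φ₂ : AddSubgroup (geomTorsion W (p : ℤ))} (h₁ : Nat.card Φ₁ = p) (h₂ : Nat.card Φ₂ = p)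
    (hne : Φ₁ ≠ Φ₂) : Φ₁ ⊔ Φ₂ = ⊤ := by
  have hp : p.Prime := Fact.out
  haveI : Finite (geomTorsion W (p : ℤ)) :=
    Nat.finite_of_card_ne_zero (by rw [hE]; exact pow_ne_zero 2 hp.ne_zero)
  have hdvd : Nat.card ↥(Φ₁ ⊔ Φ₂) ∣ p ^ 2 := hE ▸ (Φ₁ ⊔ Φ₂).card_addSubgroup_dvd_card
  obtain ⟨i, hi, hKi⟩ := (Nat.dvd_prime_pow hp).mp hdvd
  interval_cases i
  · -- order `1`: then `Φ₁ ≤ ⊥`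
    exfalso
    have hbot : Φ₁ ⊔ Φ₂ = ⊥ := AddSubgroup.card_eq_one.mp (by simpa using hKi)
    have h1 : Φ₁ = ⊥ := le_bot_iff.mp (hbot ▸ le_sup_left)
    have : Nat.card Φ₁ = 1 := by rw [h1]; exact AddSubgroup.card_bot
    rw [h₁] at this
    exact hp.one_lt.ne' this
  · -- order `p`: then `Φ₁ = Φ₁ ⊔ Φ₂ = Φ₂`
    exfalso
    have hK : Nat.card ↥(Φ₁ ⊔ Φ₂) = p := by simpa using hKi
    have e₁ : Φ₁ = Φ₁ ⊔ Φ₂ := AddSubgroup.eq_of_le_of_card_ge le_sup_left (by rw [h₁, hK])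
    have e₂ : Φ₂ = Φ₁ ⊔ Φ₂ := AddSubgroup.eq_of_le_of_card_ge le_sup_right (by rw [h₂, hK])
    exact hne (e₁.trans e₂.symm)
  · exact (AddSubgroup.card_eq_iff_eq_top _).mp (by rw [hKi, hE])

omit [W.IsElliptic] [Fact p.Prime] in
/-- If `Φ₁ ⊔ Φ₂ = ⊤` and `σ` fixes `Φ₁` and `Φ₂` pointwise, `σ` fixes `E[p]`. [folklore] -/
theorem smul_eq_self_of_sup_eq_top {Φ₁ Φ₂ : AddSubgroup (geomTorsion W (p : ℤ))}
    (htop : Φ₁ ⊔ Φ₂ = ⊤) {σ : absoluteGaloisGroup ℚ} (h₁ : ∀ P ∈ Φ₁, σ • P = P)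
    (h₂ : ∀ P ∈ Φ₂, σ • P = P) (P : geomTorsion W (p : ℤ)) : σ • P = P := by
  have hP : P ∈ Φ₁ ⊔ Φ₂ := htop ▸ AddSubgroup.mem_top P
  obtain ⟨y, hy, z, hz, rfl⟩ := AddSubgroup.mem_sup.mp hP
  rw [smul_add, h₁ y hy, h₂ z hz]

omit [W.IsElliptic] [Fact p.Prime] in
/-- If `Φ₁ ⊔ Φ₂ = ⊤` and `σ` acts by `-1` on `Φ₁` and on `Φ₂`, it acts by `-1` on `E[p]`. [folklore] -/
theorem smul_eq_neg_of_sup_eq_top {Φ₁ Φ₂ : AddSubgroup (geomTorsion W (p : ℤ))}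
    (htop : Φ₁ ⊔ Φ₂ = ⊤) {σ : absoluteGaloisGroup ℚ} (h₁ : ∀ P ∈ Φ₁, σ • P = -P)
    (h₂ : ∀ P ∈ Φ₂, σ • P = -P) (P : geomTorsion W (p : ℤ)) : σ • P = -P := by
  have hP : P ∈ Φ₁ ⊔ Φ₂ := htop ▸ AddSubgroup.mem_top P
  obtain ⟨y, hy, z, hz, rfl⟩ := AddSubgroup.mem_sup.mp hP
  rw [smul_add, h₁ y hy, h₂ z hz, neg_add]

/-! ### The type of a rational line does not depend on the line -/

omit [W.IsElliptic] in
/-- **A ramified rational line is Serre's line.** Given (hL) at `𝔓`, a rational line `Φ` which is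
NOT unramified at `p` equals the line `L` of (hL): some `τ ∈ I_𝔓` moves a point `P₀ ∈ Φ`, and
`τ • P₀ - P₀ ∈ Φ ⊓ L`. [folklore] -/
theorem eq_of_not_lineUnramifiedAt {Φ : AddSubgroup (geomTorsion W (p : ℤ))}
    (hΦ : IsRationalLine W p Φ) (hr : ¬ LineUnramifiedAt W p Φ)
    {v : HeightOneSpectrum (𝓞 ℚ)} (hv : (p : 𝓞 ℚ) ∈ v.asIdeal)
    {𝔓 : Ideal (absIntegers (𝓞 ℚ) ℚ)} (h𝔓 : 𝔓 ∈ v.primesAbove)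
    {L : AddSubgroup (geomTorsion W (p : ℤ))} (hLcard : Nat.card L = p)
    (hLsub : ∀ σ ∈ 𝔓.inertia (absoluteGaloisGroup ℚ), ∀ P : geomTorsion W (p : ℤ), σ • P - P ∈ L) :
    Φ = L := by
  rcases line_eq_or_inf_eq_bot hΦ.1 hLcard with h | h
  · exact h
  · exfalso
    obtain ⟨τ, hτ, P₀, hP₀, hne⟩ := exists_inertia_smul_ne_of_not_lineUnramifiedAt hΦ hr v hv 𝔓 h𝔓
    have hmem : τ • P₀ - P₀ ∈ Φ ⊓ L :=
      AddSubgroup.mem_inf.mpr ⟨Φ.sub_mem (hΦ.2 τ P₀ hP₀) hP₀, hLsub τ hτ P₀⟩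
    rw [h, AddSubgroup.mem_bot, sub_eq_zero] at hmem
    exact hne hmem

omit [W.IsElliptic] in
/-- **Transfer of the GV type between two rational lines, given (hL) and (hc).** `p` odd,
`#E[p] = p²`; if a rational line `Φ₁` is of Greenberg–Vatsal type then so is every rational line
`Φ₂`: for `Φ₁ ≠ Φ₂` the two lines are not both ramified (each would be Serre's line), not both
unramified (the moving element of (hL) would fix `Φ₁ ⊕ Φ₂ = E[p]`), not both even and not both
odd ((hc)), and each is even or odd (`lineEven_or_lineOdd`). [folklore] -/
theorem gvType_of_isRationalLine_of_ordinaryLine (hp2 : p ≠ 2)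
    (hE : Nat.card (geomTorsion W (p : ℤ)) = p ^ 2)
    (hL : ∀ (v : HeightOneSpectrum (𝓞 ℚ)), (p : 𝓞 ℚ) ∈ v.asIdeal → ∀ 𝔓 ∈ v.primesAbove,
      ∃ L : AddSubgroup (geomTorsion W (p : ℤ)), Nat.card L = p ∧
        (∀ σ ∈ 𝔓.inertia (absoluteGaloisGroup ℚ), ∀ P : geomTorsion W (p : ℤ), σ • P - P ∈ L) ∧
        (∃ σ ∈ 𝔓.inertia (absoluteGaloisGroup ℚ), ∃ P ∈ L, σ • P ≠ P))
    (hc : ∀ c : absoluteGaloisGroup ℚ, IsComplexConjugation (Rat.castHom ℝ) c →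
      (∃ P : geomTorsion W (p : ℤ), P ≠ 0 ∧ c • P = P) ∧
        (∃ Q : geomTorsion W (p : ℤ), Q ≠ 0 ∧ c • Q = -Q))
    {Φ₁ Φ₂ : AddSubgroup (geomTorsion W (p : ℤ))} (hΦ₁ : IsRationalLine W p Φ₁)
    (hΦ₂ : IsRationalLine W p Φ₂)
    (h₁ : (¬ LineUnramifiedAt W p Φ₁ ∧ LineEven W p Φ₁) ∨ (LineUnramifiedAt W p Φ₁ ∧ LineOdd W p Φ₁)) :
    (¬ LineUnramifiedAt W p Φ₂ ∧ LineEven W p Φ₂) ∨ (LineUnramifiedAt W p Φ₂ ∧ LineOdd W p Φ₂) := by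
  have hp : p.Prime := Fact.out
  by_cases hne : Φ₁ = Φ₂
  · exact hne ▸ h₁
  have htop : Φ₁ ⊔ Φ₂ = ⊤ := sup_eq_top_of_ne hE hΦ₁.1 hΦ₂.1 hne
  -- a prime above `p` and Serre's line there
  obtain ⟨v, hv⟩ :=
    Literature.NumberTheory.NumberFields.RingOfIntegers.exists_heightOneSpectrum_natCast_mem ℚ hp
  obtain ⟨𝔓, h𝔓⟩ := HeightOneSpectrum.primesAbove_nonempty v
  obtain ⟨L, hLcard, hLsub, σ₀, hσ₀, x₀, hx₀, hx₀ne⟩ := hL v hv 𝔓 h𝔓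
  -- not both ramified
  have nbr : ¬ LineUnramifiedAt W p Φ₁ → LineUnramifiedAt W p Φ₂ := by
    intro hr₁
    by_contra hr₂
    exact hne ((eq_of_not_lineUnramifiedAt hΦ₁ hr₁ hv h𝔓 hLcard hLsub).trans
      (eq_of_not_lineUnramifiedAt hΦ₂ hr₂ hv h𝔓 hLcard hLsub).symm)
  -- not both unramified
  have nbu : LineUnramifiedAt W p Φ₁ → ¬ LineUnramifiedAt W p Φ₂ := by
    intro hu₁ hu₂
    exact hx₀ne (smul_eq_self_of_sup_eq_top htop (hu₁ v hv 𝔓 h𝔓 σ₀ hσ₀) (hu₂ v hv 𝔓 h𝔓 σ₀ hσ₀) x₀)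
  -- a complex conjugation
  obtain ⟨c, hcc⟩ := exists_isComplexConjugation (Rat.castHom ℝ)
  -- not both even
  have nbe : LineEven W p Φ₁ → ¬ LineEven W p Φ₂ := by
    intro he₁ he₂
    obtain ⟨-, Q, hQ0, hQ⟩ := hc c hcc
    have hfix : c • Q = Q := smul_eq_self_of_sup_eq_top htop (he₁ c hcc) (he₂ c hcc) Q
    rw [hfix] at hQ
    -- `hQ : Q = -Q`
    refine hQ0 (eq_zero_of_add_self_eq_zero hp2 ?_)
    nth_rewrite 2 [hQ]
    exact add_neg_cancel Q
  -- not both odd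
  have nbo : LineOdd W p Φ₁ → ¬ LineOdd W p Φ₂ := by
    intro ho₁ ho₂
    obtain ⟨⟨P, hP0, hP⟩, -⟩ := hc c hcc
    have hneg : c • P = -P := smul_eq_neg_of_sup_eq_top htop (ho₁ c hcc) (ho₂ c hcc) P
    rw [hneg] at hP
    -- `hP : -P = P`
    refine hP0 (eq_zero_of_add_self_eq_zero hp2 ?_)
    nth_rewrite 1 [← hP]
    exact neg_add_cancel P
  rcases h₁ with ⟨hr₁, he₁⟩ | ⟨hu₁, ho₁⟩
  · -- `Φ₁` ramified and even ⇒ `Φ₂` unramified and odd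
    refine Or.inr ⟨nbr hr₁, ?_⟩
    rcases lineEven_or_lineOdd hΦ₂ with he₂ | ho₂
    · exact absurd he₂ (nbe he₁)
    · exact ho₂
  · -- `Φ₁` unramified and odd ⇒ `Φ₂` ramified and even
    refine Or.inl ⟨nbu hu₁, ?_⟩
    rcases lineEven_or_lineOdd hΦ₂ with he₂ | ho₂
    · exact he₂
    · exact absurd ho₂ (nbo ho₁)

/-- **The Greenberg–Vatsal type of a rational `p`-isogeny kernel does not depend on the kernel**
(good ordinary odd `p`, globally minimal `W`): for rational lines `Φ₁, Φ₂ ≤ E[p]`, `Φ₁` is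
(ramified ∧ even) ∨ (unramified ∧ odd) iff `Φ₂` is. The census flag M of X1-CENSUS-g2.md in the
kernel; (hL) from `exists_ordinaryLine_of_not_dvd_frobeniusTrace`, (hc) from
`exists_fixed_and_antifixed_of_isComplexConjugation`. [folklore] -/
theorem gvType_iff_of_isRationalLine [W.IsGloballyMinimal] (hp2 : p ≠ 2)
    (hgood : W.HasGoodReductionAtPrime p) (hord : ¬ (p : ℤ) ∣ W.frobeniusTrace p)
    {Φ₁ Φ₂ : AddSubgroup (geomTorsion W (p : ℤ))} (hΦ₁ : IsRationalLine W p Φ₁)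
    (hΦ₂ : IsRationalLine W p Φ₂) :
    ((¬ LineUnramifiedAt W p Φ₁ ∧ LineEven W p Φ₁) ∨ (LineUnramifiedAt W p Φ₁ ∧ LineOdd W p Φ₁)) ↔
      ((¬ LineUnramifiedAt W p Φ₂ ∧ LineEven W p Φ₂) ∨ (LineUnramifiedAt W p Φ₂ ∧ LineOdd W p Φ₂)) :=
  ⟨gvType_of_isRationalLine_of_ordinaryLine hp2 (natCard_geomTorsion W p)
      (exists_ordinaryLine_of_not_dvd_frobeniusTrace W hp2 hgood hord)
      (exists_fixed_and_antifixed_of_isComplexConjugation W hp2) hΦ₁ hΦ₂,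
    gvType_of_isRationalLine_of_ordinaryLine hp2 (natCard_geomTorsion W p)
      (exists_ordinaryLine_of_not_dvd_frobeniusTrace W hp2 hgood hord)
      (exists_fixed_and_antifixed_of_isComplexConjugation W hp2) hΦ₂ hΦ₁⟩

/-- **One rational line of co-type makes the curve of type A.** At a good ordinary odd `p`
(globally minimal `W`), if some rational line `Φ ≤ E[p]` is NOT of Greenberg–Vatsal type, then no
rational line is: `¬ GVPar W p`. [folklore] -/
theorem not_gvPar_of_isRationalLine [W.IsGloballyMinimal] (hp2 : p ≠ 2)
    (hgood : W.HasGoodReductionAtPrime p) (hord : ¬ (p : ℤ) ∣ W.frobeniusTrace p)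
    {Φ : AddSubgroup (geomTorsion W (p : ℤ))} (hΦ : IsRationalLine W p Φ)
    (h : ¬ ((¬ LineUnramifiedAt W p Φ ∧ LineEven W p Φ) ∨ (LineUnramifiedAt W p Φ ∧ LineOdd W p Φ))) :
    ¬ GVPar W p := by
  rintro ⟨Ψ, hΨ, hQ⟩
  exact h ((gvType_iff_of_isRationalLine hp2 hgood hord hΨ hΦ).mp hQ)

omit [W.IsElliptic] in
/-- Conversely, on a curve of type A with reducible `E[p]` EVERY rational line is of co-type
(unramified ∧ even) ∨ (ramified ∧ odd): a rational line is even or odd and ramified or not.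
[folklore] -/
theorem coType_of_not_gvPar {Φ : AddSubgroup (geomTorsion W (p : ℤ))} (hΦ : IsRationalLine W p Φ)
    (h : ¬ GVPar W p) :
    (LineUnramifiedAt W p Φ ∧ LineEven W p Φ) ∨ (¬ LineUnramifiedAt W p Φ ∧ LineOdd W p Φ) := by
  have hn : ¬ ((¬ LineUnramifiedAt W p Φ ∧ LineEven W p Φ) ∨ (LineUnramifiedAt W p Φ ∧ LineOdd W p Φ)) :=
    fun hQ ↦ h ⟨Φ, hΦ, hQ⟩
  rcases lineEven_or_lineOdd hΦ with he | ho
  · by_cases hu : LineUnramifiedAt W p Φ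
    · exact Or.inl ⟨hu, he⟩
    · exact absurd (Or.inl ⟨hu, he⟩) hn
  · by_cases hu : LineUnramifiedAt W p Φ
    · exact absurd (Or.inr ⟨hu, ho⟩) hn
    · exact Or.inr ⟨hu, ho⟩

/-! ### A rational point of order `p` forces type A -/

variable (W) in
omit [W.IsElliptic] in
/-- **The line spanned by a rational `p`-torsion point.** For `P ∈ E(ℚ)`, `P ≠ O`, `p • P = O`, the
subgroup `ℤ P ≤ E[p]` (through `E(ℚ) ↪ E(ℚ̄)`, `toGeomPoints`) is a rational line fixed pointwise by
`Γ_ℚ`; in particular it is unramified at `p` and even. [folklore] -/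
theorem exists_isRationalLine_of_nsmul_eq_zero (P : W.toAffine.Point) (hP0 : P ≠ 0)
    (hpP : p • P = 0) :
    ∃ Φ : AddSubgroup (geomTorsion W (p : ℤ)), IsRationalLine W p Φ ∧
      (∀ (σ : absoluteGaloisGroup ℚ), ∀ Q ∈ Φ, σ • Q = Q) ∧
      LineUnramifiedAt W p Φ ∧ LineEven W p Φ := by
  have hp : p.Prime := Fact.out
  -- the point in `E[p] ≤ E(ℚ̄)` (`convert`: the group law on `E(ℚ)` is stated here with `ℚ`'s
  -- decidable equality, in `toGeomPoints` with the classical one; the two instances are equal)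
  have hz : (p : ℤ) • W.toGeomPoints P = 0 :=
    W.zsmul_toGeomPoints_eq_zero_of_nsmul_eq_zero P (by convert hpP)
  have hmem : W.toGeomPoints P ∈ geomTorsion W (p : ℤ) :=
    (Submodule.mem_torsionBy_iff (p : ℤ) _).mpr hz
  set Q₀ : geomTorsion W (p : ℤ) := ⟨W.toGeomPoints P, hmem⟩ with hQ₀
  have hQ₀0 : Q₀ ≠ 0 := by
    intro h
    apply hP0
    apply toGeomPoints_injective W
    rw [map_zero]
    exact congrArg Subtype.val h
  have hfixQ₀ : ∀ σ : absoluteGaloisGroup ℚ, σ • Q₀ = Q₀ := fun σ ↦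
    Subtype.ext (by rw [AddSubgroup.torsionBy.coe_smul]; exact smul_toGeomPoints W σ P)
  have hfix : ∀ (σ : absoluteGaloisGroup ℚ), ∀ Q ∈ AddSubgroup.zmultiples Q₀, σ • Q = Q := by
    intro σ Q hQ
    obtain ⟨n, rfl⟩ := AddSubgroup.mem_zmultiples_iff.mp hQ
    rw [smul_comm, hfixQ₀]
  have hpQ₀ : p • Q₀ = 0 := by
    apply Subtype.ext
    simp only [AddSubmonoidClass.coe_nsmul, ZeroMemClass.coe_zero, hQ₀]
    rw [← natCast_zsmul]
    exact hz
  refine ⟨AddSubgroup.zmultiples Q₀, ⟨?_, fun σ Q hQ ↦ (hfix σ Q hQ).symm ▸ hQ⟩, hfix, ?_, ?_⟩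
  · rw [Nat.card_zmultiples, addOrderOf_eq_prime hpQ₀ hQ₀0]
  · intro v _ 𝔓 _ σ _ Q hQ
    exact hfix σ Q hQ
  · intro c _ Q hQ
    exact hfix c Q hQ

variable (W) in
/-- **A rational point of order `p` forces type A** at a good ordinary odd `p` (globally minimal
`W`): the line it spans is unramified and even, hence of co-type, so no rational line is of
Greenberg–Vatsal type (`not_gvPar_of_isRationalLine`). E.g. `11a1@5`, the conductor-`123` curve
`y² + y = x³ + x² - 10x + 10` of CGLS §0.3 at `p = 5`. [folklore] -/
theorem not_gvPar_of_nsmul_eq_zero [W.IsGloballyMinimal] (hp2 : p ≠ 2)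
    (hgood : W.HasGoodReductionAtPrime p) (hord : ¬ (p : ℤ) ∣ W.frobeniusTrace p)
    (P : W.toAffine.Point) (hP0 : P ≠ 0) (hpP : p • P = 0) : ¬ GVPar W p := by
  obtain ⟨Φ, hΦ, hfix, hu, he⟩ := exists_isRationalLine_of_nsmul_eq_zero W P hP0 hpP
  refine not_gvPar_of_isRationalLine hp2 hgood hord hΦ ?_
  rintro (⟨hr, -⟩ | ⟨-, ho⟩)
  · exact hr hu
  · -- even and odd: `Q = -Q` on a line of order `p`, `p` odd
    have hp : p.Prime := Fact.out
    obtain ⟨c, hcc⟩ := exists_isComplexConjugation (Rat.castHom ℝ)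
    haveI : Finite Φ := Nat.finite_of_card_ne_zero (by rw [hΦ.1]; exact hp.ne_zero)
    have hnt : 1 < Nat.card Φ := by rw [hΦ.1]; exact hp.one_lt
    haveI : Nontrivial Φ := Finite.one_lt_card_iff_nontrivial.mp hnt
    obtain ⟨⟨Q, hQΦ⟩, hQ0⟩ := exists_ne (0 : Φ)
    have h1 : c • Q = Q := he c hcc Q hQΦ
    have h2 : c • Q = -Q := ho c hcc Q hQΦ
    rw [h1] at h2
    apply hQ0
    apply Subtype.ext
    refine eq_zero_of_add_self_eq_zero hp2 ?_
    change Q + Q = 0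
    nth_rewrite 2 [h2]
    exact add_neg_cancel Q

variable (W) in
/-- The same on class X1: an anomalous Eisenstein prime `p ≠ 2` of good reduction with a rational
point of order `p` is of type A. [folklore] -/
theorem not_gvPar_of_anom_of_nsmul_eq_zero [W.IsGloballyMinimal] (hp2 : p ≠ 2) (h : Anom W p)
    (P : W.toAffine.Point) (hP0 : P ≠ 0) (hpP : p • P = 0) : ¬ GVPar W p :=
  not_gvPar_of_nsmul_eq_zero W hp2 (goodOrd_of_anom W p h).1 (goodOrd_of_anom W p h).2 P hP0 hpP

/-- **A rational `p`-torsion point anywhere in the isogeny class forces type A.** For globally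
minimal `W, W'`, `p ≠ 2` anomalous of good reduction for both, `ℚ`-isogenies `E ⇄ E'` not killing
the `p`-torsion, and a rational point of order `p` on `E'`: `¬ GVPar W p`
(`not_gvPar_of_anom_of_nsmul_eq_zero` for `E'` and `gvPar_iff_of_isogeny_of_anom`). Census
(X1-CENSUS-g2.md §2d): 1438 of the 1487 type-A classes `N < 2·10⁴` contain such a curve.
[folklore] -/
theorem not_gvPar_of_isogeny_of_nsmul_eq_zero [W.IsGloballyMinimal] [W'.IsGloballyMinimal]
    (hp2 : p ≠ 2) (hW : Anom W p) (hW' : Anom W' p)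
    (f : Isogeny W W') (hf : ∃ P : geomPoints W, P ∈ geomTorsion W (p : ℤ) ∧ f P ≠ 0)
    (f' : Isogeny W' W) (hf' : ∃ P : geomPoints W', P ∈ geomTorsion W' (p : ℤ) ∧ f' P ≠ 0)
    (P : W'.toAffine.Point) (hP0 : P ≠ 0) (hpP : p • P = 0) : ¬ GVPar W p := fun h ↦
  not_gvPar_of_anom_of_nsmul_eq_zero W' hp2 hW' P hP0 hpP
    ((gvPar_iff_of_isogeny_of_anom hp2 hW hW' f hf f' hf').mp h)

/-! ### Class X1 at analytic rank one with rational `p`-torsion in the class: Keller–Yin alone -/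

variable (W p) in
/-- **X1 ∧ `r_an = 1` ∧ a rational point of order `p` ⇒ `BSD(E,p)` from Keller–Yin's rank-one
display alone.** The pair is of type A (`not_gvPar_of_anom_of_nsmul_eq_zero`), so gen 1's
`bsdp_of_classX1_typeA_of_analyticRank_eq_one_of_KY_OPEN` applies: the inputs are the ANNOUNCED
Keller–Yin display (`hKY_OPEN`, arXiv:2402.12781v2 Thm. 4.2.1 via Thms 3.0.11 + 7.0.6, PRE) and the
PUBLISHED named facts Greenberg–Vatsal 2000 Thm 1.3, Greenberg 1999 Thm 4.1, modularity,
Hoffstein–Luo, Gross–Zagier I.7.3, Gross–Zagier–Kolyvagin. [cite: KellerYin2024, Thm. 4.2.1 (p. 22)] -/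
theorem bsdp_of_classX1_of_analyticRank_eq_one_of_KY_OPEN_of_nsmul_eq_zero
    (hGV : GreenbergVatsal2000.thm13_charIdeal_eq_of_gvPar) (hGr : greenberg_charValue_rankZero)
    (hmodP : nonempty_modularParametrizationData) (hmod : exists_isNewformOf)
    (hHL : HoffsteinLuo1997_exists_twist_L_one_ne_zero) (hGZ : GrossZagier1986_thm_I_7_3)
    (hGZK : rank_eq_analyticRank_of_analyticRank_le_one)
    [W.IsGloballyMinimal] (hX1 : ClassX1 W p) (hr : W.analyticRank = 1)
    (P : W.toAffine.Point) (hP0 : P ≠ 0) (hpP : p • P = 0)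
    (hKY_OPEN : ∀ (W' : WeierstrassCurve ℚ) [W'.IsElliptic] [W'.IsGloballyMinimal] (p' : ℕ)
        [Fact p'.Prime], p' ≠ 2 → W'.HasGoodReductionAtPrime p' → ¬ W'.HasIrreducibleModPGaloisRep p' →
        W'.analyticRank = 1 →
      ∀ (K : Type) [Field K] [NumberField K], IsImaginaryQuadratic K →
        Odd (NumberField.discr K) → NumberField.discr K < -4 →
        SatisfiesHeegnerHypothesis (W'.conductorNorm ℤ) K → SatisfiesHeegnerHypothesis p' K →
        (W'.quadraticTwist (NumberField.discr K : ℚ)).entireLFunction 1 ≠ 0 →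
      ∀ (Wd : WeierstrassCurve ℚ) [Wd.IsElliptic] [Wd.IsGloballyMinimal],
        (∃ C : VariableChange ℚ, C • Wd = W'.quadraticTwist (NumberField.discr K : ℚ)) →
      ∀ (q qd : ℚ), W'.leadingLCoeff / ((W'.realPeriodRat * W'.regulator : ℝ) : ℂ) = (q : ℂ) →
        Wd.entireLFunction 1 / (Wd.realPeriodRat : ℂ) = (qd : ℂ) →
        padicValRat p' q - ((padicValNat p' W'.shaOrder : ℤ) + padicValNat p' W'.tamagawaProduct -
            2 * padicValNat p' W'.torsionOrder) =
          -(padicValRat p' qd - ((padicValNat p' Wd.shaOrder : ℤ) + padicValNat p' Wd.tamagawaProduct -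
            2 * padicValNat p' Wd.torsionOrder))) :
    BSDp W p :=
  bsdp_of_classX1_typeA_of_analyticRank_eq_one_of_KY_OPEN hGV hGr hmodP hmod hHL hGZ hGZK W p hX1
    (not_gvPar_of_anom_of_nsmul_eq_zero W hX1.1.ne' hX1.2.2.2.1 P hP0 hpP) hr
    hKY_OPEN

variable (W p) in
/-- **X1 ∧ `r_an = 1` ∧ a rational point of order `p` on an ISOGENOUS curve ⇒ `BSD(E,p)` from
Keller–Yin's rank-one display alone** (`W'` globally minimal and anomalous at `p`, isogenies
`E ⇄ E'` not killing `E[p]`; type A by `not_gvPar_of_isogeny_of_nsmul_eq_zero`).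
[cite: KellerYin2024, Thm. 4.2.1 (p. 22)] -/
theorem bsdp_of_classX1_of_analyticRank_eq_one_of_KY_OPEN_of_isogeny_of_nsmul_eq_zero
    (hGV : GreenbergVatsal2000.thm13_charIdeal_eq_of_gvPar) (hGr : greenberg_charValue_rankZero)
    (hmodP : nonempty_modularParametrizationData) (hmod : exists_isNewformOf)
    (hHL : HoffsteinLuo1997_exists_twist_L_one_ne_zero) (hGZ : GrossZagier1986_thm_I_7_3)
    (hGZK : rank_eq_analyticRank_of_analyticRank_le_one)
    [W.IsGloballyMinimal] [W'.IsGloballyMinimal] (hX1 : ClassX1 W p) (hr : W.analyticRank = 1)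
    (hW' : Anom W' p)
    (f : Isogeny W W') (hf : ∃ P : geomPoints W, P ∈ geomTorsion W (p : ℤ) ∧ f P ≠ 0)
    (f' : Isogeny W' W) (hf' : ∃ P : geomPoints W', P ∈ geomTorsion W' (p : ℤ) ∧ f' P ≠ 0)
    (P : W'.toAffine.Point) (hP0 : P ≠ 0) (hpP : p • P = 0)
    (hKY_OPEN : ∀ (W' : WeierstrassCurve ℚ) [W'.IsElliptic] [W'.IsGloballyMinimal] (p' : ℕ)
        [Fact p'.Prime], p' ≠ 2 → W'.HasGoodReductionAtPrime p' → ¬ W'.HasIrreducibleModPGaloisRep p' →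
        W'.analyticRank = 1 →
      ∀ (K : Type) [Field K] [NumberField K], IsImaginaryQuadratic K →
        Odd (NumberField.discr K) → NumberField.discr K < -4 →
        SatisfiesHeegnerHypothesis (W'.conductorNorm ℤ) K → SatisfiesHeegnerHypothesis p' K →
        (W'.quadraticTwist (NumberField.discr K : ℚ)).entireLFunction 1 ≠ 0 →
      ∀ (Wd : WeierstrassCurve ℚ) [Wd.IsElliptic] [Wd.IsGloballyMinimal],
        (∃ C : VariableChange ℚ, C • Wd = W'.quadraticTwist (NumberField.discr K : ℚ)) →
      ∀ (q qd : ℚ), W'.leadingLCoeff / ((W'.realPeriodRat * W'.regulator : ℝ) : ℂ) = (q : ℂ) →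
        Wd.entireLFunction 1 / (Wd.realPeriodRat : ℂ) = (qd : ℂ) →
        padicValRat p' q - ((padicValNat p' W'.shaOrder : ℤ) + padicValNat p' W'.tamagawaProduct -
            2 * padicValNat p' W'.torsionOrder) =
          -(padicValRat p' qd - ((padicValNat p' Wd.shaOrder : ℤ) + padicValNat p' Wd.tamagawaProduct -
            2 * padicValNat p' Wd.torsionOrder))) :
    BSDp W p :=
  bsdp_of_classX1_typeA_of_analyticRank_eq_one_of_KY_OPEN hGV hGr hmodP hmod hHL hGZ hGZK W p hX1
    (not_gvPar_of_isogeny_of_nsmul_eq_zero hX1.1.ne' hX1.2.2.2.1 hW' f hf f' hf'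
      P hP0 hpP) hr hKY_OPEN

end Literature.NumberTheory.EllipticCurves.Rank1Residual

end
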